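import Mathlib
import Summits.Langlands.Langlands.Theses.PhantomRMYoshida
import Summits.Langlands.Langlands.Theorems.PhantomRMYoshidaStableYoshidaCongruenceSector
import Summits.Langlands.Langlands.Theorems.PhantomRMYoshidaStableYoshidaCongruenceLocalConditionsTransfer
import Summits.Langlands.Langlands.Theorems.PhantomRMYoshidaStableYoshidaCongruenceResidualLattice
import Summits.Langlands.Langlands.Theorems.PhantomRMYoshidaStableYoshidaCongruenceSymplecticFormFp
import Summits.Langlands.Langlands.Theorems.PhantomRMYoshidaStableYoshidaCongruenceModelFp
import Summits.Langlands.Langlands.Theorems.PhantomRMYoshidaStableYoshidaCongruenceOrdinaryFrameFp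
import Summits.Langlands.Langlands.Theorems.PhantomRMYoshidaStableYoshidaCongruenceBWSector
import Literature.NumberTheory.GaloisRepresentations.SerreWeight
import Literature.NumberTheory.GaloisRepresentations.ResidualPair
import Literature.AlgebraicGeometry.Motives.FaltingsAbelian
import Literature.AlgebraicGeometry.Motives.FaltingsFinitenessI
import Literature.AlgebraicGeometry.Motives.FaltingsAbelianOfFinitenessIProofs

/-!
# Line `burkhardt-weddle-two-three-anchor` — checked skeleton (lead c1 reshape) for the crux
`Summit.Langlands.Langlands.Theses.PhantomRMYoshida.StableYoshidaCongruence` (stmt-Langlands-13640)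

Planner crux-plan round 1 (idea card `burkhardt-weddle-two-three-anchor`, ideator 3; triage r1: pass ×3,
merge ≈ `level-three-weierstrass-switch`), RESHAPED by line lead c1 (prover-line-stmt-Langlands-13640-c1-0,
2026-08-16) onto the LANDED infrastructure of the sibling line `level-three-weierstrass-switch` (LTWS):

* LTWS's sector theorem `stub_sectorModuloFacts` (Theorems/…Sector.lean, p94938) already proves, from the
  landed stubs 1a/1b/2/3i/3ii, that the five published facts (Faltings ×2, Serre–Tate, BCGP2025 switch +
  2-adic modularity, Weil pairing) give `p = 3 → Switchable 3 k σ σ' → CruxAt 3 k red σ σ'`, where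
  `Switchable` POSITS a symplectic-`ε̄⁻¹` `GSp₄(𝔽₃)`-model of `σ ⊕ σ'` that is ordinary-with-unramified-sub
  and peu ramifié at `3` and unramified at `2` off `4C/12C` (verbatim the hypotheses of arXiv:2502.20645
  Lemma 9.4.2).
* THIS line's own content (the planner's Stubs 1–2) is exactly what turns the crux's OWN hypotheses into
  `Switchable`: the `𝔽_p`-MODEL is DERIVED from `𝔽_p`-rationality of `charpoly σ · charpoly σ'`
  (`stub_modelFp`: Deligne–Serre 6.13 for `n = 2` — tree `exists_descent_fin_two` — twice, restriction of
  scalars in the phantom-RM case `σ' ≅ σ^(p)`, Brauer–Nesbitt), its SYMPLECTIC FORM from `det = ε̄⁻¹` +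
  non-conjugacy (`stub_symplecticFormFp`: the invariant alternating forms are an `𝔽_p`-plane whose degenerate
  members lie on two lines), and its ORDINARY `𝔽_p`-FRAME from the crux's `Sh`-witness H5
  (`stub_residualLattice`: a `Γ_ℚ`-stable `𝒪_{ℚ̄_p}`-lattice adapted to the Greenberg flag and its reduction;
  `stub_ordinaryFrameFp`: the reduction has a `Γ_ℚ`-stable plane `≅ σ` or `σ'`, whose intersection with the
  inertia-trivial plane gives unramified stable LINES of `σ|Γ_v`, `σ'|Γ_v` — the orientation that H5 certifies,
  Disproof.lean §4 — and the inertia invariants of the model descend the frame to `𝔽_p`); the local side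
  conditions pass to the model by a kernel computation (`stub_localConditionsTransfer`).
* So the BW SECTOR is `p = 3 ∧ (charpoly σ · charpoly σ' is 𝔽₃-rational) ∧ (σ, σ' peu ramifié at 3) ∧
  (σ, σ' unramified at 2, product of Frobenius polynomials ≠ (X² ± X + 2)²)` — strictly LARGER than LTWS's
  (model, symplectic form and ordinary frame are no longer assumed), and it contains the route's motivating
  phantom-RM case `σ̄' = σ̄^(3)` whenever peu ramifié at `3` and switchable at `2`.
* STATUS (skeleton v3, 2026-08-16T17:15Z): Stubs 1–5 and the sector theorem Stub 8 have LANDED under `Theorems/` (p116898, p116812,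
  p114963, p116455, p117060, p117182); the only `sorry`s left are Stub 6 (four published facts) and Stub 7 (the open remainder).
* The four published facts enter as ONE bundled registered obligation `stub_sectorFacts`, keyed to the route's
  own named-fact gate items: Faltings through `FaltingsFinitenessI` (stmt-Langlands-15084; Satz 3/4 follow
  in-tree, `FaltingsAbelianOfFinitenessIProofs`), Serre–Tate, BCGP, Weil (Literature facts p86833, p92170,
  p86824).  They are theorems in print, not worker tasks.
* `stub_offSector` is the crux off the BW sector — the honest open remainder (all `p ≥ 5`: `A₂(p)`-twists of
  general type; the D-residue; `p = 3` pairs that are très ramifié / ramified at 2 / in `4C ∪ 12C` / not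
  `𝔽₃`-rational), expected dimension `-1` (Disproof §6).  NOT claimed; `promote-stub` material.

## Shape (data flow of `StableYoshidaCongruence_of`, sorry-free glue at the end)

`crux_iff` (LTWS, `Iff.rfl`) ↦ `CruxAt p k red σ σ'`; classical split on the BW sector:
* in the sector (`p = 3`): H5 gives `ρw` with `Sh`; `stub_residualLattice ρw` ↦ reduction `M`;
  `stub_modelFp` ↦ `ρb` with `IsModelOf ρb σ σ'`; `stub_symplecticFormFp` ↦ symplectic-`ε̄⁻¹`;
  `stub_ordinaryFrameFp M ρb` ↦ the ordinary `𝔽₃`-frame; `stub_localConditionsTransfer` ↦ peu ramifié and the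
  conditions at `2` for `ρb`; assemble `Switchable 3 k σ σ'`; `stub_sectorFacts` + LTWS `stub_sectorModuloFacts`
  ↦ `CruxAt`.
* off the sector: `stub_offSector`.

## Disproof used (Cruxes/StableYoshidaCongruence/Disproof.lean, cdisprove cycle 3, read in full 2026-08-16)

* §2 `exists_cuspForm_of_not_crux`: no `_false_without_H` theorem exists for this crux — nothing to honour by
  name.  §4 `loadBearing` honoured: H5 (`∃ ρ, Sh ρ`) is consumed TWICE here — for the ordinary orientation of
  `σ|Γ_v`, `σ'|Γ_v` (`stub_residualLattice` → `stub_ordinaryFrameFp`; §4: "H5 ⟺ (σ̄, σ̄') is an ordinary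
  p-distinguished Yoshida pair", forward direction, made a lemma) and, inside the imported LTWS transfer
  (1a/1b), for residual distinguishedness of `ρ₀`.  H1 (`AutGL2`) is decoration (§3.5) and is threaded only to
  `stub_offSector`; H3/H4 feed `stub_symplecticFormFp` (multiplier, cross term) and the remainder.
* §3.2 Irr'-trap avoided: no stub takes an irreducible witness.  §5 R2 = this sector; R1/D1/R4 ⊂ `stub_offSector`.
* No `Negative/` lemma has landed (nothing to import); negatives index: 1 unrelated entry (K3 Kuga–Satake).
-/

set_option linter.dupNamespace false
set_option linter.unusedVariables false

noncomputable section

open CategoryTheory IsDedekindDomain Polynomial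
open scoped NumberField
open Literature.NumberTheory.GaloisRepresentations Literature.NumberTheory.Automorphic
open Literature.AlgebraicGeometry.Motives (AbelianVariety
  faltings_tate_bijective_of_forall_finite_isoClasses_isogenous
  isSemisimpleRepresentation_rationalTateRep_of_finite_isoClasses_isogenous)
open Literature.AlgebraicGeometry.Motives.AbelianVariety (finite_isoClasses_isogenous)
open Literature.NumberTheory.DiophantineGeometry (weilPairing_rationalTateModule
  ordinaryReduction_tateModule_filtration bcgp_switch_exists_modular_abelianSurface)
open Summit.Langlands.Langlands.Theses.PhantomRMYoshida
open Summit.Langlands.Langlands.Cruxes.StableYoshidaCongruence.LevelThreeWeierstrassSwitch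

namespace Summit.Langlands.Langlands.Cruxes.StableYoshidaCongruence.BurkhardtWeddleTwoThreeAnchor

/-! ## Vocabulary — all imported from the landed LTWS files (`Sh`, `AutGL2`, `AutGL4`, `DetCond`, `NonConj`,
`CruxAt`, `crux_iff`, `epsBar`, `toK`, `IsModelOf`, `IsOrdinaryFlatAt`, `IsSwitchableAtTwo`, `Switchable`);
the only new name is the sector predicate. -/

section Sector

variable (p : ℕ) [Fact p.Prime] (k : Type) [Field k] [CharP k p] [TopologicalSpace k] [DiscreteTopology k]

/-- **The Burkhardt–Weddle sector** at the data `(p, k, σ, σ')`: `p = 3`; the pair is `𝔽_p`-RATIONAL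
(every `charpoly σ(g) · charpoly σ'(g)` comes from `𝔽_p[X]` — both constituents `𝔽_p`-rational, or the
phantom-RM pair `σ' ≅ σ^(p)` over `𝔽_{p²}`); `σ|Γ_{ℚ_v}`, `σ'|Γ_{ℚ_v}` are PEU RAMIFIÉES at `v ∣ p`; and at
`v ∣ 2` both are unramified with `P₁ P₂ ≠ (X² ± X + 2)²` for some (hence all) Frobenius polynomials
`P₁, P₂` (⇔ `Frob₂ ∉ 4C ∪ 12C`, arXiv:2502.20645 Thm 9.5.2 (2)).  The symplectic `𝔽_p`-model and its ordinary
frame are NOT part of the sector: they are derived (Stubs 1–5). -/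
def BWSector (σ σ' : FramedGaloisRep ℚ k 2) : Prop :=
  p = 3 ∧
  (∀ g : Field.absoluteGaloisGroup ℚ, ∃ Q : Polynomial (ZMod p),
      Q.map (ZMod.castHom (dvd_refl p) k) = FramedRep.charpoly σ g * FramedRep.charpoly σ' g) ∧
  (∀ v : HeightOneSpectrum (𝓞 ℚ), ((p : ℕ) : 𝓞 ℚ) ∈ v.asIdeal →
      ModPGaloisRep.IsPeuRamifie (σ.toLocal v) ∧ ModPGaloisRep.IsPeuRamifie (σ'.toLocal v)) ∧
  (∀ v : HeightOneSpectrum (𝓞 ℚ), ((2 : ℕ) : 𝓞 ℚ) ∈ v.asIdeal →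
      σ.IsUnramifiedAt v ∧ σ'.IsUnramifiedAt v ∧
      ∃ P₁ P₂ : Polynomial k, σ.HasFrobCharpolyAt v P₁ ∧ σ'.HasFrobCharpolyAt v P₂ ∧
        P₁ * P₂ ≠ (X ^ 2 + X + C 2) ^ 2 ∧ P₁ * P₂ ≠ (X ^ 2 - X + C 2) ^ 2)

end Sector

/-! ## Stub 1 — the `𝔽_p`-model of an `𝔽_p`-rational pair (DESCENT; LANDED) -/

/- **Stub 1 (`stub_modelFp`) — LANDED** (p116898, 2026-08-16, wave 1, worker w-modelFp):
`Summits/Langlands/Langlands/Theorems/PhantomRMYoshidaStableYoshidaCongruenceModelFp.lean` declares `stub_modelFp` in THIS namespace with the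
registered signature (imported above), on top of `…ModelFpDescent.lean` (p116476: Brauer–Nesbitt conjugacy `exists_conj_blockDiag`,
`isIrreducible_of_charpoly_eq`, `exists_conj_of_equiv`) and `…ModelFpDichotomy.lean` (p116711: `frobenius_dichotomy`, Case A
`exists_model_of_frobenius_fixed` by Deligne–Serre 6.13 for n = 2 twice); Case B (phantom-RM swap) = descent over 𝔽_{p²} + restriction of
scalars made explicit as a Galois descent `T D T⁻¹` entrywise Frobenius-fixed. [cite: DeligneSerreASENS1974, Lemme 6.13] -/

/-! ## Stub 2 — the symplectic `𝔽_p`-form of the model (LANDED) -/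

/- **Stub 2 (`stub_symplecticFormFp`) — LANDED** (p116812, 2026-08-16, wave 1, worker w-symplecticFormFp):
`Summits/Langlands/Langlands/Theorems/PhantomRMYoshidaStableYoshidaCongruenceSymplecticFormFp.lean` declares `stub_symplecticFormFp`
in THIS namespace with the registered signature (imported above; + helper file `…SymplecticFormFpAltInv.lean` p116661: invariant alternating
forms, Schur via the route's landed `YoshidaResidualSp4Schur` lemmas `det_ne_zero_of_intertwiner` / `exists_conj_of_intertwiner`, descent
`mem_span_map_of_isAltInv`, the two degenerate lines `ab = 0`). [cite: BoxerEtAl2021, §2.1; Isaacs1976, Cor. 9.22] -/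

/-! ## Stub 3 — the local side conditions pass from `(σ, σ')` to the model (provable now, small) -/

/- **Stub 3 (`stub_localConditionsTransfer`) — LANDED** (p114963, 2026-08-16, wave 1, worker w-localTransfer):
`Summits/Langlands/Langlands/Theorems/PhantomRMYoshidaStableYoshidaCongruenceLocalConditionsTransfer.lean` declares
`stub_localConditionsTransfer` in THIS namespace with the registered signature (imported above; 151 lines; kernel
computation `ρb τ = 1 ⟺ σ τ = 1 ∧ σ' τ = 1`, uniqueness of Frobenius polynomials, `IsModelOf.charpoly_map`).  Reusable there:
`apply_eq_one_of_isModelOf`, `isUnramifiedAt_of_isModelOf`, `isPeuRamifie_toLocal_of_isModelOf`, `isSwitchableAtTwo_of_isModelOf`,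
`map_exceptional_quartic`. [cite: Serre1987, §2.4; BoxerCalegariGeePilloni2025, Thm. 9.5.2 (2)] -/

/-! ## Stub 4 — the residual lattice of the `Sh`-witness, adapted to the Greenberg flag (the lead's stub; LANDED) -/

/- **Stub 4 (`stub_residualLattice`) — LANDED** (p116455, 2026-08-16, the lead's stub):
`Summits/Langlands/Langlands/Theorems/PhantomRMYoshidaStableYoshidaCongruenceResidualLattice.lean` declares
`stub_residualLattice` in THIS namespace with the registered signature (imported above; 283 lines), on top of three landed
helper files (registered sub-goals): `…ResidualLatticeCharpoly.lean` (p115123: pointwise residual factorisation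
`exists_map_red_charpoly_eq_mul_of_hasResidualPair`, closed + dense locus, Chebotarev), `…ResidualLatticeFrame.lean`
(p115712: `exists_GL_adapted_flag` — an integral change of basis in `GL₄(O)` adapted to a flag, `O` any valuation
subring), `…ResidualLatticeFlag.lean` (p116229: the `4 × 4` identity `conj_flag_shape`, `inv_flag_shape`).  Output
clauses: (M1) charpolys of `σ ⊕ σ'` everywhere; (M2) block/triangular shape at `v`; (M3) inertia trivial on the top
block; (M4) distinct top diagonal characters (any Greenberg frame of a residually distinguished `ρ` is distinguished,
LTWS 1b lemmas). [cite: SerreAbelianLadic1968, Ch. I §1.1 Remark 1, §2.3; DeligneSerreASENS1974, 6.12; Greenberg1991, §2;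
BoxerEtAl2021, §7.3] -/

/-! ## Stub 5 — the ordinary `𝔽_p`-frame of the model from the residual lattice (LANDED) -/

/- **Stub 5 (`stub_ordinaryFrameFp`) — LANDED** (p117060, 2026-08-16, wave 1, worker w-ordinaryFrameFp):
`Summits/Langlands/Langlands/Theorems/PhantomRMYoshidaStableYoshidaCongruenceOrdinaryFrameFp.lean` declares `stub_ordinaryFrameFp` in THIS
namespace with the registered signature (imported above), on top of `…OrdinaryFrameFpOrientation.lean` (p116651: ORIENTATION — the inertia
invariants of `σ|Γ_v`, `σ'|Γ_v` are LINES: the inertia-trivial top plane of `M` (M2–M3), left-exactness of invariants under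
semisimplification `exists_semisimplification_invariants`, Brauer–Nesbitt `M^{ss} ≅ σ ⊕ σ'` from (M1), and `dim σ^{I} ≤ 1` because
`det σ = ε̄⁻¹` takes the value `-1 ≠ 1` on inertia) and `…OrdinaryFrameFpDescent.lean` (`frame_descent`: `U = ker(ρb(τ₀) − 1) ⊂ 𝔽_p⁴` is a
`Γ_v`-stable plane, inertia-trivial, scalar `ε̄⁻¹` on the quotient).  This is Disproof.lean §4's "H5 certifies the ordinary p-distinguished
pair", forward direction, as a theorem. [cite: BoxerCalegariGeePilloni2025, Cor. 9.3.5, Lemma 9.4.2; BourbakiAlgebreVIII2012, VIII § 20 n° 6] -/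

/-! ## Stub 6 — the four PUBLISHED FACTS of the sector lever, bundled (not a worker task) -/

/-- **Stub 6 (`stub_sectorFacts`; published theorems, bundled as ONE registered obligation).**  The sector
composition (LTWS `stub_sectorModuloFacts`, landed p94938) rests on four theorems in print, none proved in Lean:
(F1) FALTINGS — through the route's named-fact gate item `FaltingsFinitenessI` (stmt-Langlands-15084: Finiteness I
over `ℚ`, Faltings 1983 §6 Satz 5–6), from which Satz 3 (semisimplicity of `V_p B`) and Satz 4 / Korollar 1
(Tate conjecture for `End`) follow IN THE TREE (`FaltingsAbelianOfFinitenessIProofs`: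
`isSemisimpleRepresentation_rationalTateRep_of_finite_isoClasses_isogenous`,
`faltings_tate_bijective_of_forall_finite_isoClasses_isogenous`); (F2) SERRE–TATE — the ordinary filtration of
`V_p B` for good ordinary reduction (Literature `ordinaryReduction_tateModule_filtration`, p86833); (F3) BCGP2025 —
the `2`–`3` switch lands on a modular abelian surface, Lemma 9.4.2 + Thm 8.3.2 + transfer as in Thm 9.5.2
(Literature `bcgp_switch_exists_modular_abelianSurface`, p92170); (F4) WEIL — `V_p B` is symplectic with multiplier
`χ_p` (Literature `weilPairing_rationalTateModule`, p86824).  Discharged exactly by `_holds` proofs of these four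
facts; until then the line is CLOSED MODULO them on its sector (Census `What is missing`).
[cite: Faltings1983Endlichkeit, §5 Satz 3–4, §6 Satz 5–6; SerreTate1968GoodReduction, §1; Greenberg1991, §2;
BoxerCalegariGeePilloni2025, Lemma 9.4.2, Thm. 8.3.2, Thm. 9.5.2; Milne1986AbelianVarieties, §16] -/
theorem stub_sectorFacts :
    FaltingsFinitenessI ∧ ordinaryReduction_tateModule_filtration ∧
      bcgp_switch_exists_modular_abelianSurface ∧ weilPairing_rationalTateModule := by
  sorry

/-! ## Stub 7 — the HONEST REMAINDER: the crux off the Burkhardt–Weddle sector (open; not claimed) -/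

/-- **Stub 7 (`stub_offSector`, OPEN — the remainder this line does NOT attack).**  For data outside the
Burkhardt–Weddle sector `BWSector p k σ σ'` — every odd `p ≠ 3` (regime R4 of Disproof §5: generic pairs,
`A₂(p)`-twists of general type — Hulek–Sankaran — so no Diophantine supply; the settled functorial sub-regimes
R1/D1 live here too), and at `p = 3` the pairs whose `charpoly σ · charpoly σ'` is not `𝔽₃`-rational, or which are
très ramifié at `3`, or ramified at `2`, or have `Frob₂ ∈ 4C ∪ 12C` — the crux `CruxAt p k red σ σ'` as filed.
Strictly WEAKER than the crux (the sector is excluded) but it carries all of its generic difficulty: expected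
dimension of the deformation problem `-1` independently of the level (Disproof §6), no engine proposed by any line
for generic `p ≥ 5`; a RIGID PAIR (Disproof §3.4) off the sector refutes it and the crux with it.  The lead does
not attack it: `promote-stub` / planner split ("p = 3 sector" child — this line + LTWS — and "the rest"), or the
tenure restatement to `Irr'` (Disproof `closes_irr'`).  Size: open (XL⁺).
[cite: BoxerCalegariGeePilloni2025, Remark 9.4.4; HulekSankaran2002; Sorensen2006; Sorensen2009; LemmaOchiai2023;
HsiehPalvannan2025; DeoPalvannan2026 (arXiv:2602.20737)] -/
theorem stub_offSector :
    ∀ (p : ℕ) [Fact p.Prime], p ≠ 2 → ∀ (k : Type) [Field k] [CharP k p] [IsAlgClosed k]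
      [TopologicalSpace k] [DiscreteTopology k] (red : Valued.integer (PadicAlgCl p) →+* k)
      (σ σ' : FramedGaloisRep ℚ k 2),
      ¬ BWSector p k σ σ' → CruxAt p k red σ σ' := by
  sorry

/-! ## Stub 8 — the BW SECTOR THEOREM (LANDED) -/

/- **Stub 8 (`stub_bwSectorModuloFacts`) — LANDED** (p117182, 2026-08-16, lead): the BW SECTOR THEOREM
`Summits/Langlands/Langlands/Theorems/PhantomRMYoshidaStableYoshidaCongruenceBWSector.lean` declares `stub_bwSectorModuloFacts` (and the
sorry-free composition `switchable_of_bwSector`: Stubs 1–5 ⇒ LTWS `Switchable`) in THIS namespace with the registered signature (imported above):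
(FaltingsFinitenessI, Serre–Tate, BCGP, Weil) → ∀ data in the Burkhardt–Weddle sector, `CruxAt` — the crux CLOSED IN LEAN on the BW sector
modulo exactly the four published facts of Stub 6.  The skeleton's former in-file composition (`switchable_of_sector`,
`faltings_of_finitenessI`, `bwSectorModuloFacts_of_stubs`) is now that landed file. -/

/-! ## Glue (sorry-free): the crux from Stub 6 (facts), Stub 8 (landed sector theorem) and Stub 7 (open remainder) -/

/-- **`StableYoshidaCongruence` from the line `burkhardt-weddle-two-three-anchor`** (lead c1 skeleton v3).  Regime split on the
Burkhardt–Weddle sector.  IN the sector: Stub 6 supplies the four published facts and the LANDED sector theorem Stub 8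
(`stub_bwSectorModuloFacts`, p117182 — the composition of the landed Stubs 1–5 with the sibling line's `stub_sectorModuloFacts`) returns
`CruxAt`.  OFF the sector: Stub 7 (the honest open remainder).  Sorries left: Stub 6 (published facts) and Stub 7 (the open problem). -/
theorem StableYoshidaCongruence_of : StableYoshidaCongruence := by
  refine crux_iff.mpr fun p _ hp k _ _ _ _ _ red σ σ' => ?_
  by_cases hsec : BWSector p k σ σ'
  · obtain ⟨hFI, hST, hBCGP, hWeil⟩ := stub_sectorFacts
    -- the in-sector branch: the landed sector theorem (Stub 8 = Stubs 1–5 ∘ LTWS `stub_sectorModuloFacts`)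
    exact stub_bwSectorModuloFacts hFI hST hBCGP hWeil p hp k red σ σ' hsec
  · exact stub_offSector p hp k red σ σ' hsec

end Summit.Langlands.Langlands.Cruxes.StableYoshidaCongruence.BurkhardtWeddleTwoThreeAnchor

end
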